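import Literature.Computability.QuantumComplexity.QTMCircuitStep
import Literature.Computability.QuantumComplexity.RevTableauUniform
import Literature.Computability.QuantumComplexity.UniformSubstitution
import HarnessLib

/-!
# The circuit simulating a quantum Turing machine, IV: the description of the circuits as an explicit list function

Fifth file of the formalisation of the simulation of (unidirectional) quantum Turing machines by
quantum circuits (Yao 1993; Nishimura–Ozawa 2002, Thm. 4.3). The simulating family `yaoFamily M D p`
(`QTMCircuitStep.lean`) is uniform: its description is printed in polynomial time. Following the
tree's treatment of uniformity (`RevTableauUniform.lean`, `UniformSubstitution.lean`), this is
split into a LIST IDENTITY (this file) and a membership-in-`FP` argument on codes (the sequel):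

* the circuit wires of all wire kinds as closed arithmetic expressions in `n`, `W`
  (`val_ywEquiv_*`);
* `rawOfOp`, `map_toRaw_revCompile_toRevList`, `rawGates_compileY` — the raw gates
  (`QGate.toRaw`: tag, symbol code, wire list) of a compiled reversible program are the
  concatenation, operation by operation, of the fixed Clifford+`T` patterns `RevDesc.agates` on
  the `ℕ`-valued wires;
* `fetchN`, `moveN`, `initN`, `outputN`, `locRaw`, `stepRaw`, **`yaoRaw M D n T`** — the same
  programs with wires in `ℕ` given by closed formulas, and **`rawDesc_yaoFamily`**:
  `(yaoFamily M D p).rawDesc n = (n, anc, yaoRaw M D n (p n))`.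

No named facts are introduced.

## References

* S. Arora, B. Barak, *Computational Complexity: A Modern Approach*, CUP 2009, §6.1–6.2
  (descriptions of circuits; `P`-uniform families, "output the description gate by gate")
  [AroraBarak2009].
* H. Nishimura, M. Ozawa, *Computational complexity of uniform quantum circuit families and
  quantum Turing machines*, Theoret. Comput. Sci. 276 (2002) 147–181, §2.2 (polynomial-time
  uniform families: the code of `K_n` computed by a DTM in time polynomial in `n`), Thm. 4.3
  [NishimuraOzawa2002].
-/

noncomputable section

namespace Literature.Computability.QuantumComplexity

namespace YaoSim

open Cryptography QTM Function Turing RevDesc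
open scoped BigOperators

variable {M : QTM} {n W : ℕ}

/-! ### The circuit wires of all wire kinds -/

variable (M n W) in
/-- The circuit wire of a wire, as a natural number. [folklore] -/
def vN (i : YW M n W) : ℕ := (ywEquiv M n W i : ℕ)

/-- The base of the state register. [folklore] -/
theorem vN_st (q : M.Λ) : vN M n W (.st q) = n + Fintype.equivFin M.Λ q := rfl
/-- The wires of the symbol register. [folklore] -/
theorem vN_reg (τ : M.Γ) : vN M n W (.reg τ) = n + (kq M + Fintype.equivFin M.Γ τ) := rfl
/-- The direction wire. [folklore] -/
theorem vN_dir : vN M n W .dir = n + (kq M + ks M) := rfl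
/-- The answer wire. [folklore] -/
theorem vN_ans : vN M n W .ans = n + (kq M + ks M + 1) := rfl
/-- The input wires. [folklore] -/
theorem vN_inp (i : Fin n) : vN M n W (.inp i) = i := rfl
/-- The cell wires: `n + |Q| + |Σ| + 2 + (τ + |Σ|·j)`. [folklore] -/
theorem vN_cell (j : Fin W) (τ : M.Γ) :
    vN M n W (.cell j τ) = n + (kq M + ks M + 1 + 1 + (Fintype.equivFin M.Γ τ + ks M * j)) := rfl
/-- The head wires: `n + |Q| + |Σ| + 2 + W|Σ| + j`. [folklore] -/
theorem vN_head (j : Fin W) : vN M n W (.head j) = n + (kq M + ks M + 1 + 1 + W * ks M + j) := rfl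

/-! ### Raw gates of compiled reversible programs -/

/-- The raw gate of an abstract Clifford+`T` gate on `ℕ`-valued wires (tag `false`, symbol code,
wires). [cite: AroraBarak2009, §6.1] -/
def rawOfAGate (g : AGate ℕ) : RawGate := (false, (symCode g.sym, g.wires))

/-- The raw gates of the Clifford+`T` word of a reversible operation (`X = HSSH`, `CNOT`,
Toffoli `= H·CCZ·H`, `RevDesc.agates`). [cite: NielsenChuang2010, §4.3 Fig. 4.9] -/
def rawOfOp (op : ClOp ℕ) : List RawGate := (agates op).map rawOfAGate

variable {N : ℕ}

/-- Raw gate of a placed Hadamard. [folklore] -/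
theorem toRaw_hOn (i : Fin N) : (hOn i).toRaw = (false, (0, [i.val])) := rfl
/-- Raw gate of a placed `S`. [folklore] -/
theorem toRaw_sOn (i : Fin N) : (sOn i).toRaw = (false, (1, [i.val])) := rfl
/-- Raw gate of a placed `T`. [folklore] -/
theorem toRaw_tOn (i : Fin N) : (tOn i).toRaw = (false, (2, [i.val])) := rfl
/-- Raw gate of a placed `CNOT`. [folklore] -/
theorem toRaw_cnotOn (i j : Fin N) (h : i ≠ j) : (cnotOn i j h).toRaw = (false, (3, [i.val, j.val])) := by
  show (false, (Encodable.encode CliffordTOp.CNOT,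
    List.ofFn fun k : Fin 2 => (((![i, j] : Fin 2 → Fin N) k : Fin N) : ℕ))) = _
  simp only [List.ofFn_succ, List.ofFn_zero]
  rfl

/-- **The raw gates of the compiled word of a well-formed operation on `Fin N`** are the abstract
pattern on the values of its wires. [folklore] -/
theorem map_toRaw_compile_toRev (op : ClOp (Fin N)) (h : op.WF) :
    (op.toRev h).compile.map QGate.toRaw = rawOfOp (op.map Fin.val) := by
  cases op with
  | not i => rfl
  | cnot i j =>
    simp [ClOp.toRev, RevOp.compile, toRaw_cnotOn, rawOfOp, agates, ClOp.map, rawOfAGate, symCode]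
  | toffoli a b c =>
    simp [ClOp.toRev, RevOp.compile, toffoliWord, cczWord, toRaw_cnotOn, toRaw_hOn, toRaw_sOn,
      toRaw_tOn, rawOfOp, agates, ClOp.map, rawOfAGate, symCode]

/-- The raw gates of a compiled program on `Fin N`. [folklore] -/
theorem map_toRaw_revCompile_toRevList :
    ∀ (ops : List (ClOp (Fin N))) (h : ∀ op ∈ ops, op.WF),
      (revCompile (toRevList ops h)).map QGate.toRaw = ops.flatMap fun op => rawOfOp (op.map Fin.val)
  | [], _ => rfl
  | op :: ops, h => by
    rw [toRevList, revCompile_cons, List.map_append, List.flatMap_cons, map_toRaw_compile_toRev,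
      map_toRaw_revCompile_toRevList ops]

/-- Transport into the gate set does not change raw gates (the Clifford+`T` symbols keep their
codes). [folklore] -/
theorem toRaw_ofCT (D : M.Λ → Dir) (γ : QGate cliffordT N) :
    (γ.ofCT D : QGate (yaoGateSet M D) N).toRaw = γ.toRaw := by
  cases γ with
  | gate g e => exact Prod.ext rfl (Prod.ext (encode_ct g) rfl)
  | oracle k e => rfl

/-- `ClOp.map` composes. [folklore] -/
theorem clop_map_map {α β γ : Type*} (f : α → β) (g : β → γ) (op : ClOp α) :
    (op.map f).map g = op.map (g ∘ f) := by
  cases op <;> rfl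

/-- **The raw gates of a compiled program on the wires `YW`**: operation by operation, the fixed
patterns on the circuit wires `vN`. [cite: AroraBarak2009, §6.1] -/
theorem map_toRaw_compileY (D : M.Λ → Dir) (ops : List (ClOp (YW M n W))) (h : ∀ op ∈ ops, op.WF) :
    (compileY D ops h).map QGate.toRaw = ops.flatMap fun op => rawOfOp (op.map (vN M n W)) := by
  rw [compileY, List.map_map, show QGate.toRaw ∘ QGate.ofCT D = (QGate.toRaw : QGate cliffordT _ → RawGate)
    from funext (toRaw_ofCT D), map_toRaw_revCompile_toRevList, List.flatMap_map]
  refine List.flatMap_congr fun op _ => ?_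
  show rawOfOp (((op.map (ywEquiv M n W)).map Fin.val)) = _
  rw [clop_map_map]
  rfl

/-! ### The programs with wires in `ℕ` -/

variable (M) in
/-- The layout constants: bases of the symbol register, the cells and the head track, for the
window size `W`. [folklore] -/
def R0 (n : ℕ) : ℕ := n + kq M
/-- Base of the cells. [folklore] -/
def C0 (M : QTM) (n : ℕ) : ℕ := n + (kq M + ks M + 1 + 1)
/-- Base of the head track. [folklore] -/
def H0 (M : QTM) (n W : ℕ) : ℕ := n + (kq M + ks M + 1 + 1 + W * ks M)
/-- The direction wire. [folklore] -/
def D0 (M : QTM) (n : ℕ) : ℕ := n + (kq M + ks M)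
/-- The answer wire. [folklore] -/
def A0 (M : QTM) (n : ℕ) : ℕ := n + (kq M + ks M + 1)

/-- `cswapRegs` of two lists mapped from the same list is a `flatMap` of Fredkin words. [folklore] -/
theorem cswapRegs_map_map {ι κ : Type*} (c : ι) (f g : κ → ι) :
    ∀ l : List κ, cswapRegs c (l.map f) (l.map g) = l.flatMap fun k => cswap c (f k) (g k)
  | [] => rfl
  | k :: l => by rw [List.map_cons, List.map_cons, cswapRegs_cons, List.flatMap_cons, cswapRegs_map_map c f g l]

/-- `ClOp.map` over `cswap`. [folklore] -/
theorem map_cswap {ι κ : Type*} (f : ι → κ) (c a b : ι) :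
    (cswap c a b).map (ClOp.map f) = cswap (f c) (f a) (f b) := rfl

variable (M) in
/-- `fetch` with wires in `ℕ`: for `j < W` and `t < |Σ|`, the Fredkin word with control
`H0 + j` exchanging `C0 + (t + |Σ| j)` and `R0 + t`. [cite: NishimuraOzawa2002, Thm. 4.3 (proof)] -/
def fetchN (n W : ℕ) : List (ClOp ℕ) :=
  (List.range W).flatMap fun j => (List.range (ks M)).flatMap fun t =>
    cswap (H0 M n W + j) (C0 M n + (t + ks M * j)) (R0 M n + t)

/-- `symList` re-indexed by the numbering is the range. [folklore] -/
theorem map_equivFin_symList : (symList M).map (fun τ => (Fintype.equivFin M.Γ τ : ℕ)) = List.range (ks M) := by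
  rw [symList, List.map_map, ← List.map_coe_finRange_eq_range]
  exact List.map_congr_left fun i _ => by simp

/-- **`fetch` on circuit wires is `fetchN`.** [folklore] -/
theorem map_vN_fetch : (fetch M n W).map (ClOp.map (vN M n W)) = fetchN M n W := by
  unfold fetch fetchN
  rw [List.map_flatMap, ← List.map_coe_finRange_eq_range (n := W), List.flatMap_map]
  refine List.flatMap_congr fun j _ => ?_
  simp only [cellL, regL, cswapRegs_map_map, List.map_flatMap, map_cswap]
  rw [← map_equivFin_symList, List.flatMap_map]
  refine List.flatMap_congr fun τ _ => ?_
  have e1 : vN M n W (.head j) = H0 M n W + j := by rw [vN_head, H0]; omega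
  have e2 : vN M n W (.cell j τ) = C0 M n + (Fintype.equivFin M.Γ τ + ks M * j) := by
    rw [vN_cell, C0]; omega
  have e3 : vN M n W (.reg τ) = R0 M n + Fintype.equivFin M.Γ τ := by rw [vN_reg, R0]; omega
  show cswap (vN M n W (.head j)) (vN M n W (.cell j τ)) (vN M n W (.reg τ)) = _
  rw [e1, e2, e3]

/-- `ClOp.map` over `xorInto`. [folklore] -/
theorem map_xorInto {ι κ : Type*} (f : ι → κ) (srcs : List ι) (t : ι) :
    (xorInto srcs t).map (ClOp.map f) = xorInto (srcs.map f) (f t) := by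
  simp only [xorInto, List.map_map]
  rfl

/-- `ClOp.map` over `rotR`. [folklore] -/
theorem map_rotR {ι κ : Type*} (f : ι → κ) (c : ι) (h : ℕ → ι) :
    ∀ W : ℕ, (rotR c h W).map (ClOp.map f) = rotR (f c) (f ∘ h) W
  | 0 => rfl
  | 1 => rfl
  | W + 2 => by
    rw [rotR_succ_succ, rotR_succ_succ, List.map_append, map_rotR f c h (W + 1), map_cswap]
    rfl

/-- `ClOp.map` over `rotL`. [folklore] -/
theorem map_rotL {ι κ : Type*} (f : ι → κ) (c : ι) (h : ℕ → ι) (W : ℕ) :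
    (rotL c h W).map (ClOp.map f) = rotL (f c) (f ∘ h) W := by
  simp only [rotL, List.map_flatMap, map_cswap]
  rfl

/-- `rotR` only depends on the track below `W`. [folklore] -/
theorem rotR_congr {ι : Type*} (c : ι) {h h' : ℕ → ι} :
    ∀ W : ℕ, (∀ j < W, h j = h' j) → rotR c h W = rotR c h' W
  | 0, _ => rfl
  | 1, _ => rfl
  | W + 2, hh => by
    rw [rotR_succ_succ, rotR_succ_succ, hh W (by omega), hh (W + 1) (by omega),
      rotR_congr c (W + 1) fun j hj => hh j (by omega)]

/-- `rotL` only depends on the track below `W`. [folklore] -/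
theorem rotL_congr {ι : Type*} (c : ι) {h h' : ℕ → ι} (W : ℕ) (hh : ∀ j < W, h j = h' j) :
    rotL c h W = rotL c h' W := by
  unfold rotL
  refine List.flatMap_congr fun j hj => ?_
  rw [List.mem_range] at hj
  rw [hh j (by omega), hh (j + 1) (by omega)]

/-- `rotR` as a `flatMap` over the reversed range: the Fredkin words on the cells
`(W-2, W-1), (W-3, W-2), …, (0, 1)`. [folklore] -/
theorem rotR_eq_flatMap_reverse {ι : Type*} (c : ι) (h : ℕ → ι) :
    ∀ W : ℕ, rotR c h W = ((List.range (W - 1)).reverse).flatMap fun j => cswap c (h j) (h (j + 1))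
  | 0 => rfl
  | 1 => rfl
  | W + 2 => by
    rw [rotR_succ_succ, rotR_eq_flatMap_reverse c h (W + 1), show W + 2 - 1 = W + 1 from rfl,
      show W + 1 - 1 = W from rfl, List.range_succ, List.reverse_append, List.reverse_singleton,
      List.singleton_append, List.flatMap_cons]

variable (M) in
/-- The numbers of the right-moving states. [cite: BernsteinVaziraniSICOMP1997, Def. 3.14] -/
def rightIdx (D : M.Λ → Dir) : List ℕ := (rightStates M D).map fun q => (Fintype.equivFin M.Λ q : ℕ)

variable (M) in
/-- `move` with wires in `ℕ`. [cite: NishimuraOzawa2002, Thm. 4.3 (proof)] -/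
def moveN (D : M.Λ → Dir) (n W : ℕ) : List (ClOp ℕ) :=
  xorInto ((rightIdx M D).map (n + ·)) (D0 M n) ++
    (((List.range (W - 1)).reverse.flatMap fun j => cswap (D0 M n) (H0 M n W + j) (H0 M n W + (j + 1))) ++
      ([ClOp.not (D0 M n)] ++
        (((List.range (W - 1)).flatMap fun j => cswap (D0 M n) (H0 M n W + j) (H0 M n W + (j + 1))) ++
          ([ClOp.not (D0 M n)] ++ xorInto ((rightIdx M D).map (n + ·)) (D0 M n)))))

/-- The head track on circuit wires, below `W`. [folklore] -/
theorem vN_hTrack {j : ℕ} (hj : j < W) : vN M n W (hTrack M n W j) = H0 M n W + j := by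
  rw [hTrack_of_lt hj, vN_head, H0]
  show n + (kq M + ks M + 1 + 1 + W * ks M + j) = _
  omega

/-- **`move` on circuit wires is `moveN`.** [folklore] -/
theorem map_vN_move (D : M.Λ → Dir) : (move M D n W).map (ClOp.map (vN M n W)) = moveN M D n W := by
  have hx : (xorInto ((rightStates M D).map YW.st) YW.dir).map (ClOp.map (vN M n W)) =
      xorInto ((rightIdx M D).map (n + ·)) (D0 M n) := by
    rw [map_xorInto, List.map_map, rightIdx, List.map_map]; rfl
  have hR : (rotR YW.dir (hTrack M n W) W).map (ClOp.map (vN M n W)) =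
      (List.range (W - 1)).reverse.flatMap fun j => cswap (D0 M n) (H0 M n W + j) (H0 M n W + (j + 1)) := by
    rw [map_rotR]
    show rotR (vN M n W YW.dir) (fun j => vN M n W (hTrack M n W j)) W = _
    rw [rotR_congr (vN M n W YW.dir) (h' := fun j => H0 M n W + j) W fun j hj => vN_hTrack hj,
      rotR_eq_flatMap_reverse]
    rfl
  have hL : (rotL YW.dir (hTrack M n W) W).map (ClOp.map (vN M n W)) =
      (List.range (W - 1)).flatMap fun j => cswap (D0 M n) (H0 M n W + j) (H0 M n W + (j + 1)) := by
    rw [map_rotL]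
    show rotL (vN M n W YW.dir) (fun j => vN M n W (hTrack M n W j)) W = _
    rw [rotL_congr (vN M n W YW.dir) (h' := fun j => H0 M n W + j) W fun j hj => vN_hTrack hj]
    rfl
  simp only [move, moveN, List.map_append, hx, hR, hL, List.map_cons, List.map_nil]
  rfl

/-- `ClOp.map` over `writeSel`. [folklore] -/
theorem map_writeSel {ι κ α : Type*} (f : ι → κ) (x : ι) (tgt : α → ι) (e₀ e₁ : α → Bool) (ks : List α) :
    (writeSel x tgt e₀ e₁ ks).map (ClOp.map f) = writeSel (f x) (f ∘ tgt) e₀ e₁ ks := by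
  simp only [writeSel, List.map_flatMap]
  refine List.flatMap_congr fun k _ => ?_
  rw [List.map_append]
  congr 1 <;> split_ifs <;> rfl

/-- `writeSel` over a mapped key list. [folklore] -/
theorem writeSel_map {ι α β : Type*} (x : ι) (tgt : β → ι) (e₀ e₁ : β → Bool) (g : α → β) (l : List α) :
    writeSel x tgt e₀ e₁ (l.map g) = writeSel x (tgt ∘ g) (e₀ ∘ g) (e₁ ∘ g) l := by
  simp only [writeSel, List.flatMap_map]
  rfl

variable (M) in
/-- The bit pattern of the code of `embed b`, on symbol numbers. [folklore] -/
def eBit (b : Bool) (t : ℕ) : Bool := decide ((Fintype.equivFin M.Γ (M.embed b) : ℕ) = t)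

variable (M) in
/-- Loading input bit `x` into the cell with window index `b`: selective writes of the code of
`embed x`. [cite: NishimuraOzawa2002, Thm. 4.3 (proof)] -/
def writeSelN (n x b : ℕ) : List (ClOp ℕ) :=
  writeSel x (fun t => C0 M n + (t + ks M * b)) (eBit M false) (eBit M true) (List.range (ks M))

variable (M) in
/-- `initOps` with wires in `ℕ`. [cite: NishimuraOzawa2002, Thm. 4.3 (proof)] -/
def initN (n T : ℕ) : List (ClOp ℕ) :=
  (((List.range (Wd n T)).filter fun j => !decide (T ≤ j ∧ j < T + n)).map fun j =>
      ClOp.not (C0 M n + ((Fintype.equivFin M.Γ default : ℕ) + ks M * j))) ++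
    ((List.range n).flatMap fun i => writeSelN M n i (T + i)) ++
    [ClOp.not (n + (Fintype.equivFin M.Λ M.start : ℕ)), ClOp.not (H0 M n (Wd n T) + T)]

/-- **`initOps` on circuit wires is `initN`.** [folklore] -/
theorem map_vN_initOps (T : ℕ) : (initOps M n T).map (ClOp.map (vN M n (Wd n T))) = initN M n T := by
  -- blank cells
  have hA : (((List.finRange (Wd n T)).filter fun j : Fin (Wd n T) => !decide (T ≤ j.val ∧ j.val < T + n)).map
      (fun j => ClOp.not (YW.cell j (default : M.Γ)))).map (ClOp.map (vN M n (Wd n T))) =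
      ((List.range (Wd n T)).filter fun j => !decide (T ≤ j ∧ j < T + n)).map fun j =>
        ClOp.not (C0 M n + ((Fintype.equivFin M.Γ default : ℕ) + ks M * j)) := by
    rw [List.map_map, ← List.map_coe_finRange_eq_range (n := Wd n T), List.filter_map, List.map_map]
    refine List.map_congr_left fun j _ => ?_
    show ClOp.not (vN M n (Wd n T) (.cell j default)) =
      ClOp.not (C0 M n + ((Fintype.equivFin M.Γ default : ℕ) + ks M * (j : ℕ)))
    rw [vN_cell, C0]
    congr 1
    omega
  -- input cells
  have hB : ((List.finRange n).flatMap fun i : Fin n =>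
      writeSel (YW.inp i) (fun τ => YW.cell (inCell n T i) τ)
        (fun τ => decide (M.embed false = τ)) (fun τ => decide (M.embed true = τ)) (symList M)).map
        (ClOp.map (vN M n (Wd n T))) =
      (List.range n).flatMap fun i => writeSelN M n i (T + i) := by
    rw [List.map_flatMap, ← List.map_coe_finRange_eq_range (n := n), List.flatMap_map]
    refine List.flatMap_congr fun i _ => ?_
    show (writeSel (YW.inp i) (fun τ => YW.cell (inCell n T i) τ) (fun τ => decide (M.embed false = τ))
      (fun τ => decide (M.embed true = τ)) (symList M)).map (ClOp.map (vN M n (Wd n T))) =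
      writeSelN M n i (T + i)
    rw [map_writeSel, writeSelN, symList, writeSel_map, ← List.map_coe_finRange_eq_range, writeSel_map]
    unfold writeSel
    refine List.flatMap_congr fun t _ => ?_
    have ht : vN M n (Wd n T) (.cell (inCell n T i) ((Fintype.equivFin M.Γ).symm t)) =
        C0 M n + ((t : ℕ) + ks M * (T + i)) := by
      rw [vN_cell, C0]
      show n + (kq M + ks M + 1 + 1 + ((Fintype.equivFin M.Γ ((Fintype.equivFin M.Γ).symm t) : ℕ) +
        ks M * (T + (i : ℕ)))) = _
      simp only [Equiv.apply_symm_apply]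
      omega
    have h0 : ∀ b, (decide (M.embed b = (Fintype.equivFin M.Γ).symm t)) = eBit M b t := fun b => by
      simp [eBit, Equiv.eq_symm_apply, Fin.ext_iff]
    simp only [Function.comp_apply, ht, h0, vN_inp]
  have hC : vN M n (Wd n T) (.head ⟨T, by dsimp only [Wd]; omega⟩) = H0 M n (Wd n T) + T := by
    rw [vN_head, H0]
    show n + (kq M + ks M + 1 + 1 + Wd n T * ks M + T) = _
    omega
  unfold initOps initN
  rw [List.map_append, List.map_append, hA, hB, List.map_cons, List.map_cons, List.map_nil]
  show _ ++ _ ++ [ClOp.not (vN M n (Wd n T) (.st M.start)), ClOp.not (vN M n (Wd n T) (.head ⟨T, _⟩))] = _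
  rw [hC, vN_st]

/-- Wire `0` as a natural number. [folklore] -/
theorem vN_wire0 : vN M n W (wire0 M n W) = 0 := by
  have h : 0 < n + anc M W := Nat.add_pos_right _ (anc_pos W)
  rw [vN, ywEquiv_wire0 h]

variable (M) in
/-- `outputOps` with wires in `ℕ` (wire `0` of the circuit is `wire0`). [folklore] -/
def outputN (n : ℕ) : List (ClOp ℕ) :=
  [ClOp.cnot (n + (Fintype.equivFin M.Λ M.accept : ℕ)) (A0 M n),
    ClOp.cnot (A0 M n) 0, ClOp.cnot 0 (A0 M n), ClOp.cnot (A0 M n) 0]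

/-- **`outputOps` on circuit wires is `outputN`.** [folklore] -/
theorem map_vN_outputOps : (outputOps M n W).map (ClOp.map (vN M n W)) = outputN M n := by
  simp only [outputOps, outputN, List.map_cons, List.map_nil]
  show [ClOp.cnot (vN M n W (.st M.accept)) (vN M n W .ans), ClOp.cnot (vN M n W .ans) (vN M n W (wire0 M n W)),
    ClOp.cnot (vN M n W (wire0 M n W)) (vN M n W .ans), ClOp.cnot (vN M n W .ans) (vN M n W (wire0 M n W))] = _
  rw [vN_wire0, vN_st, vN_ans]
  rfl

/-! ### The raw description of the simulating circuit -/

/-- The raw gates of a program with wires in `ℕ`. [cite: AroraBarak2009, §6.1] -/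
def rawOfOps (ops : List (ClOp ℕ)) : List RawGate := ops.flatMap rawOfOp

variable (M) in
/-- The raw gate of the local gate: tag `false`, code `4`, the wires `n, …, n + |Q| + |Σ| - 1`. [folklore] -/
def locRaw (n : ℕ) : RawGate := (false, (4, (List.range (kq M + ks M)).map (n + ·)))

/-- The placement of the local gate, as naturals: `n + i`. [folklore] -/
theorem val_eSR (i : Fin (kq M + ks M)) : (eSR M n W i : ℕ) = n + i := by
  show vN M n W (srWire M n W i) = n + i
  induction i using Fin.addCases with
  | left i => rw [srWire, Fin.append_left, vN_st]; simp
  | right i => rw [srWire, Fin.append_right, vN_reg]; simp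

/-- The raw gate of the placed local gate. [folklore] -/
theorem toRaw_locGate (D : M.Λ → Dir) : (locGate M n W D).toRaw = locRaw M n := by
  show (false, (Encodable.encode YOp.loc, List.ofFn fun i => (eSR M n W i : ℕ))) = _
  rw [encode_loc, locRaw, List.ofFn_eq_map, ← List.map_coe_finRange_eq_range, List.map_map]
  simp only [Function.comp_def, val_eSR]

variable (M) in
/-- The raw gates of one simulated step. [cite: NishimuraOzawa2002, Thm. 4.3 (proof)] -/
def stepRaw (D : M.Λ → Dir) (n T : ℕ) : List RawGate :=
  rawOfOps (fetchN M n (Wd n T)) ++ ([locRaw M n] ++ (rawOfOps (fetchN M n (Wd n T)) ++ rawOfOps (moveN M D n (Wd n T))))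

variable (M) in
/-- **The raw gates of the simulating circuit**, as an explicit list function of `n` and `T`. [cite: AroraBarak2009, §6.1–6.2] -/
def yaoRaw (D : M.Λ → Dir) (n T : ℕ) : List RawGate :=
  rawOfOps (initN M n T) ++ ((List.replicate T (stepRaw M D n T)).flatten ++ rawOfOps (outputN M n))

/-- Raw gates of a compiled program, through the `ℕ`-valued program. [folklore] -/
theorem map_toRaw_compileY' (D : M.Λ → Dir) (ops : List (ClOp (YW M n W))) (h : ∀ op ∈ ops, op.WF) :
    (compileY D ops h).map QGate.toRaw = rawOfOps (ops.map (ClOp.map (vN M n W))) := by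
  rw [map_toRaw_compileY, rawOfOps, List.flatMap_map]

/-- The raw gates of one step block. [folklore] -/
theorem map_toRaw_stepGates (D : M.Λ → Dir) (n T : ℕ) :
    (stepGates M D n T).map QGate.toRaw = stepRaw M D n T := by
  simp only [stepGates, stepRaw, List.map_append, List.map_cons, List.map_nil, map_toRaw_compileY',
    map_vN_fetch, map_vN_move, toRaw_locGate]

/-- **The raw description of the simulating family is `yaoRaw`.** [cite: AroraBarak2009, §6.1–6.2] -/
theorem rawDesc_yaoFamily (D : M.Λ → Dir) (p : Polynomial ℕ) (n : ℕ) :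
    (yaoFamily M D p).rawDesc n = (n, (anc M (Wd n (p.eval n)), yaoRaw M D n (p.eval n))) := by
  show (n, (anc M (Wd n (p.eval n)), (yaoGates M D n (p.eval n)).map QGate.toRaw)) = _
  simp only [yaoGates, yaoRaw, List.map_append, List.map_flatten, List.map_replicate, map_toRaw_compileY',
    map_vN_initOps, map_vN_outputOps, map_toRaw_stepGates]

end YaoSim

end Literature.Computability.QuantumComplexity

end
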